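import Summits.BirchSwinnertonDyer.BirchSwinnertonDyer.Theorems.BiquadraticEisensteinDescentEisensteinHeartFlatCMInertBadKPrimeBiquadraticCMType
import HarnessLib

set_option linter.dupNamespace false -- `Summit.BirchSwinnertonDyer.BirchSwinnertonDyer.Theorems.…` (summit = sub)
set_option autoImplicit false

/-!
# Crux `EisensteinHeartFlatCMInertBadKPrime` (stmt-BirchSwinnertonDyer-21341), line `hsieh-lambda`, layer 2 —
# INSTANTIATION tranche 3: the `Σ`-orientation of the Katz frame at `L = K_CM·K′` — `σ ∈ Σ` (for `Σ_p = {𝔓′}`) iff `σ`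
# restricts to the CONJUGATE of the `𝔭`-compatible embedding of `K′`; Hsieh's (d1) and the sign of `Im σ(ϑ)` for `ϑ ∈ K′`

Sequel of `…BiquadraticCMType.lean` (width seat `bsd-wall-cm-bed-w2`; THEOREMS ONLY, helper toward
stmt-BirchSwinnertonDyer-21341, nothing about the crux's input or any case of BSD asserted).

## Setting and what is proved

The item supplies `ι′ : ℚ̄_p ≃ ℂ` COMPATIBLE with the degree-one prime `𝔭` of the Heegner field `K = K′`:
`∀ (w : InfinitePlace K) (k : 𝓞 K), k ∈ 𝔭 ↔ ‖ι′⁻¹ (w.embedding k)‖ < 1`. The Katz frame of the V2 memo has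
`Σ_p(L) = {𝔓′}`, `𝔓′ ∣ 𝔭′ = c 𝔭`, and `σ ∈ Σ` is the tree's `KatzCM.InSigma ι′ {𝔓′} σ :=` "the place of `ι′⁻¹ ∘ σ` is `𝔓′`".

* §1 the place of a `p`-adic embedding restricts along `K ⊂ L` (`under_place_comp`); a `𝔭`-compatible `ι` puts the place of
  `ι⁻¹ ∘ φ₀` at `𝔭` (`place_eq_of_compatible`) and, for the CM field `K`, the place of `ι⁻¹ ∘ φ̄₀` at `𝔭′` (`place_conjugate_eq`:
  `φ̄₀ = φ₀ ∘ c_K` and `c_K` swaps `𝔭, 𝔭′`, `…BiquadraticCMType.complexConj_smul_mem_of_ne`).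
* §2 every complex embedding `σ` of `L` restricts to `φ₀` or `φ̄₀` on the imaginary quadratic `K` (`comp_algebraMap_eq_or`), the
  place of `ι⁻¹ ∘ σ` is accordingly THE prime `𝔓 ∣ 𝔭` or `𝔓′ ∣ 𝔭′` (`place_eq_of_comp_eq`, `place_eq_of_comp_eq_conjugate`, by
  `…BiquadraticPrimes.liesOver_unique`), hence **`KatzCM.InSigma ι {𝔓′} σ ↔ σ ∘ (K → L) = φ̄₀`** (`inSigma_singleton_iff`) and
  dually `KatzCM.InSigma ι {𝔓} σ ↔ σ ∘ (K → L) = φ₀`.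
* §3 Hsieh's (d1) and the `Σ`-positivity for a `ϑ ∈ K′`: if `c_K y = −y` then every `σ(y)` is purely imaginary
  (`re_apply_eq_zero_of_complexConj_eq_neg` — hypothesis `hϑ₁` of `KatzCM.exists_isBaseChangeLine`), and for `σ ∈ Σ`
  `Im σ(y) = −Im φ₀(y)` (`im_apply_of_inSigma`), so `Im φ₀(y) < 0` gives `hϑ₂` (`im_apply_pos_of_inSigma`); such a `y ≠ 0` exists
  (`exists_complexConj_eq_neg_im_neg`). (Hsieh's (d2) — `ord_w(2ϑ) = ord_w 𝒟_{L/ℚ}` on the bookkeeping set `D` — is NOT addressed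
  here; it needs an approximation argument in `L⁺`.)

References: [NeukirchANT1999] Ch. II (8.1)–(8.3) (places above `p` ↔ `p`-adic embeddings); [Hsieh2014mu] §1.1 (`Σ`, `Σ_p`,
`ι_p = ι⁻¹ ∘ ι_∞`), §3.1 (d1).
-/

noncomputable section

open scoped Classical NumberField ComplexConjugate
open NumberField IsDedekindDomain Module

namespace Summit.BirchSwinnertonDyer.BirchSwinnertonDyer.Theorems.BiquadraticEisensteinDescentEisensteinHeartFlatCMInertBadKPrimeSigmaOrientation

open Literature.NumberTheory.EllipticCurves Literature.NumberTheory.GaloisRepresentations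
open Summit.BirchSwinnertonDyer.BirchSwinnertonDyer.Theorems.BiquadraticEisensteinDescentEisensteinHeartFlatCMInertBadKPrimeBiquadraticPrimes
open Summit.BirchSwinnertonDyer.BirchSwinnertonDyer.Theorems.BiquadraticEisensteinDescentEisensteinHeartFlatCMInertBadKPrimeBiquadraticCMType

variable {K L : Type} [Field K] [NumberField K] [Field L] [NumberField L] [Algebra K L]
variable {p : ℕ} [hp : Fact p.Prime]

/-! ### §1 Places of `p`-adic embeddings: restriction to `K`, the `𝔭`-compatible `ι`, and its conjugate -/

/-- **The place of a `p`-adic embedding restricts**: the prime of `K` below the place of `τ : L → ℚ̄_p` is the place of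
`τ|_K`. [cite: NeukirchANT1999, Ch. II Thm. (8.1)] -/
theorem under_place_comp (τ : L →+* PadicAlgCl p) :
    (PadicEmbedding.place τ).under (𝓞 K) = PadicEmbedding.place (τ.comp (algebraMap K L)) := by
  apply HeightOneSpectrum.ext
  ext d
  change algebraMap (𝓞 K) (𝓞 L) d ∈ (PadicEmbedding.place τ).asIdeal ↔ _
  change ‖τ ((algebraMap (𝓞 K) (𝓞 L) d : 𝓞 L) : L)‖ < 1 ↔ ‖(τ.comp (algebraMap K L)) (d : K)‖ < 1
  rfl

/-- A `𝔭`-COMPATIBLE pair `(ι, φ₀)` — `k ∈ 𝔭 ↔ ‖ι⁻¹(φ₀ k)‖ < 1`, the item's binder at `φ₀ = w.embedding` — puts the place of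
`ι⁻¹ ∘ φ₀` at `𝔭`. [cite: Hsieh2014mu, §1.1 (`ι_p := ι⁻¹ ∘ ι_∞`)] -/
theorem place_eq_of_compatible {ι : PadicAlgCl p ≃+* ℂ} {φ₀ : K →+* ℂ} {𝔭 : HeightOneSpectrum (𝓞 K)}
    (hι : ∀ k : 𝓞 K, k ∈ 𝔭.asIdeal ↔ ‖ι.symm (φ₀ (k : K))‖ < 1) :
    PadicEmbedding.place ((ι.symm : ℂ ≃+* PadicAlgCl p).toRingHom.comp φ₀) = 𝔭 := by
  apply HeightOneSpectrum.ext
  ext d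
  exact (hι d).symm

omit [Algebra K L] in
/-- **… and the place of `ι⁻¹ ∘ φ̄₀` at the OTHER prime `𝔭′`** (`K` a CM field, e.g. imaginary quadratic, with `𝔭 ≠ 𝔭′` above `p`):
`φ̄₀ = φ₀ ∘ c_K` and `c_K` swaps `𝔭` and `𝔭′`. [cite: Hsieh2014mu, §1.1] [cite: NeukirchANT1999, Ch. I §9] -/
theorem place_conjugate_eq [IsCMField K] (h2K : finrank ℚ K = 2) {ι : PadicAlgCl p ≃+* ℂ} {φ₀ : K →+* ℂ}
    {𝔭 𝔭' : HeightOneSpectrum (𝓞 K)} (hι : ∀ k : 𝓞 K, k ∈ 𝔭.asIdeal ↔ ‖ι.symm (φ₀ (k : K))‖ < 1)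
    (h𝔭 : ((p : ℕ) : 𝓞 K) ∈ 𝔭.asIdeal) (h𝔭' : ((p : ℕ) : 𝓞 K) ∈ 𝔭'.asIdeal) (hne : 𝔭 ≠ 𝔭') :
    PadicEmbedding.place ((ι.symm : ℂ ≃+* PadicAlgCl p).toRingHom.comp (ComplexEmbedding.conjugate φ₀)) = 𝔭' := by
  apply HeightOneSpectrum.ext
  ext d
  change ‖ι.symm (ComplexEmbedding.conjugate φ₀ (d : K))‖ < 1 ↔ d ∈ 𝔭'.asIdeal
  rw [ComplexEmbedding.conjugate_coe_eq, ← IsCMField.complexEmbedding_complexConj K φ₀]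
  have hc : ((IsCMField.complexConj K • d : 𝓞 K) : K) = IsCMField.complexConj K (d : K) := rfl
  rw [← hc, ← hι]
  have hcc : IsCMField.complexConj K • (IsCMField.complexConj K • d) = d := by
    apply Subtype.ext
    change IsCMField.complexConj K (IsCMField.complexConj K (d : K)) = d
    exact IsCMField.complexConj_apply_apply K (d : K)
  constructor
  · intro h
    have := complexConj_smul_mem_of_ne (p := p) h2K h𝔭 h𝔭' hne h
    rwa [hcc] at this
  · intro h
    exact complexConj_smul_mem_of_ne (p := p) h2K h𝔭' h𝔭 hne.symm h

/-! ### §2 Restriction of embeddings of `L` to the imaginary quadratic `K`; `InSigma ι {𝔓′}` -/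

omit [NumberField L] in
/-- Every complex embedding of `L` restricts on the imaginary quadratic `K` to `φ₀` or to `φ̄₀` (one infinite place).
[cite: NeukirchANT1999, Ch. III §1] -/
theorem comp_algebraMap_eq_or (hK : IsImaginaryQuadratic K) (φ₀ : K →+* ℂ) (σ : L →+* ℂ) :
    σ.comp (algebraMap K L) = φ₀ ∨ σ.comp (algebraMap K L) = ComplexEmbedding.conjugate φ₀ := by
  haveI : Subsingleton (InfinitePlace K) := Fintype.card_le_one_iff_subsingleton.mp hK.card_infinitePlace_eq_one.le
  have hmk : InfinitePlace.mk (σ.comp (algebraMap K L)) = InfinitePlace.mk φ₀ := Subsingleton.elim _ _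
  rcases InfinitePlace.mk_eq_iff.mp hmk with h | h
  · exact Or.inl h
  · right
    rw [← h]
    exact (ComplexEmbedding.involutive_conjugate K _).symm

/-- If `σ|_K = φ₀` (the `𝔭`-compatible embedding) then the place of `ι⁻¹ ∘ σ` is THE prime `𝔓` of `L` above `𝔭`.
[cite: Hsieh2014mu, §1.1] [cite: NeukirchANT1999, Ch. II Thm. (8.1)] -/
theorem place_eq_of_comp_eq (h4 : finrank ℚ L = 4) {d : ℤ} (hd : ¬ IsSquare ((d : ℤ) : ZMod p)) {x : 𝓞 L}
    (hx : x ^ 2 = (d : 𝓞 L)) {𝔭 𝔭' : HeightOneSpectrum (𝓞 K)} (h𝔭 : ((p : ℕ) : 𝓞 K) ∈ 𝔭.asIdeal)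
    (h𝔭' : ((p : ℕ) : 𝓞 K) ∈ 𝔭'.asIdeal) (hne : 𝔭 ≠ 𝔭') {𝔓 : HeightOneSpectrum (𝓞 L)} [𝔓.asIdeal.LiesOver 𝔭.asIdeal]
    {ι : PadicAlgCl p ≃+* ℂ} {φ₀ : K →+* ℂ} (hι : ∀ k : 𝓞 K, k ∈ 𝔭.asIdeal ↔ ‖ι.symm (φ₀ (k : K))‖ < 1)
    {σ : L →+* ℂ} (hσ : σ.comp (algebraMap K L) = φ₀) :
    PadicEmbedding.place ((ι.symm : ℂ ≃+* PadicAlgCl p).toRingHom.comp σ) = 𝔓 := by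
  set τ := (ι.symm : ℂ ≃+* PadicAlgCl p).toRingHom.comp σ with hτ
  have hunder : (PadicEmbedding.place τ).under (𝓞 K) = 𝔭 := by
    rw [under_place_comp, hτ, RingHom.comp_assoc, hσ]
    exact place_eq_of_compatible hι
  haveI : (PadicEmbedding.place τ).asIdeal.LiesOver 𝔭.asIdeal := ⟨congrArg HeightOneSpectrum.asIdeal hunder.symm⟩
  exact liesOver_unique h4 hd hx h𝔭 h𝔭' hne

/-- If `σ|_K = φ̄₀` then the place of `ι⁻¹ ∘ σ` is THE prime `𝔓′` of `L` above `𝔭′`. [cite: Hsieh2014mu, §1.1] -/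
theorem place_eq_of_comp_eq_conjugate [IsCMField K] (hK : IsImaginaryQuadratic K) (h4 : finrank ℚ L = 4) {d : ℤ}
    (hd : ¬ IsSquare ((d : ℤ) : ZMod p)) {x : 𝓞 L} (hx : x ^ 2 = (d : 𝓞 L)) {𝔭 𝔭' : HeightOneSpectrum (𝓞 K)}
    (h𝔭 : ((p : ℕ) : 𝓞 K) ∈ 𝔭.asIdeal) (h𝔭' : ((p : ℕ) : 𝓞 K) ∈ 𝔭'.asIdeal) (hne : 𝔭 ≠ 𝔭')
    {𝔓' : HeightOneSpectrum (𝓞 L)} [𝔓'.asIdeal.LiesOver 𝔭'.asIdeal] {ι : PadicAlgCl p ≃+* ℂ} {φ₀ : K →+* ℂ}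
    (hι : ∀ k : 𝓞 K, k ∈ 𝔭.asIdeal ↔ ‖ι.symm (φ₀ (k : K))‖ < 1) {σ : L →+* ℂ}
    (hσ : σ.comp (algebraMap K L) = ComplexEmbedding.conjugate φ₀) :
    PadicEmbedding.place ((ι.symm : ℂ ≃+* PadicAlgCl p).toRingHom.comp σ) = 𝔓' := by
  set τ := (ι.symm : ℂ ≃+* PadicAlgCl p).toRingHom.comp σ with hτ
  have hunder : (PadicEmbedding.place τ).under (𝓞 K) = 𝔭' := by
    rw [under_place_comp, hτ, RingHom.comp_assoc, hσ]
    exact place_conjugate_eq hK.1 hι h𝔭 h𝔭' hne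
  haveI : (PadicEmbedding.place τ).asIdeal.LiesOver 𝔭'.asIdeal := ⟨congrArg HeightOneSpectrum.asIdeal hunder.symm⟩
  exact liesOver_unique h4 hd hx h𝔭' h𝔭 hne.symm

/-- **`σ ∈ Σ` for `Σ_p = {𝔓′}` iff `σ` restricts to the conjugate `φ̄₀` of the `𝔭`-compatible embedding of `K′`**
(`KatzCM.InSigma ι {𝔓′} σ ↔ σ ∘ (K → L) = φ̄₀`) — the `Σ`-orientation of the Katz frame of the V2 memo (`Σ_p(L) = {𝔓′}`,
`𝔓′ ∣ 𝔭′ = c 𝔭`) in terms of the item's compatible `ι′`. [cite: Hsieh2014mu, §1.1 (`Σ_p = {w : w induced by ι_p ∘ σ, σ ∈ Σ}`)] -/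
theorem inSigma_singleton_iff [IsCMField K] (hK : IsImaginaryQuadratic K) (h4 : finrank ℚ L = 4) {d : ℤ}
    (hd : ¬ IsSquare ((d : ℤ) : ZMod p)) {x : 𝓞 L} (hx : x ^ 2 = (d : 𝓞 L)) {𝔭 𝔭' : HeightOneSpectrum (𝓞 K)}
    (h𝔭 : ((p : ℕ) : 𝓞 K) ∈ 𝔭.asIdeal) (h𝔭' : ((p : ℕ) : 𝓞 K) ∈ 𝔭'.asIdeal) (hne : 𝔭 ≠ 𝔭')
    {𝔓 𝔓' : HeightOneSpectrum (𝓞 L)} [𝔓.asIdeal.LiesOver 𝔭.asIdeal] [𝔓'.asIdeal.LiesOver 𝔭'.asIdeal]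
    {ι : PadicAlgCl p ≃+* ℂ} {φ₀ : K →+* ℂ} (hι : ∀ k : 𝓞 K, k ∈ 𝔭.asIdeal ↔ ‖ι.symm (φ₀ (k : K))‖ < 1)
    (σ : L →+* ℂ) :
    KatzCM.InSigma ι ({𝔓'} : Finset (HeightOneSpectrum (𝓞 L))) σ ↔
      σ.comp (algebraMap K L) = ComplexEmbedding.conjugate φ₀ := by
  have hne' : 𝔓 ≠ 𝔓' := ne_of_liesOver_ne hne
  unfold KatzCM.InSigma
  rw [Finset.mem_singleton]
  constructor
  · intro h
    rcases comp_algebraMap_eq_or hK φ₀ σ with hσ | hσ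
    · rw [place_eq_of_comp_eq h4 hd hx h𝔭 h𝔭' hne (𝔓 := 𝔓) hι hσ] at h
      exact absurd h hne'
    · exact hσ
  · intro hσ
    exact place_eq_of_comp_eq_conjugate hK h4 hd hx h𝔭 h𝔭' hne (𝔓' := 𝔓') hι hσ

/-- Dually, `KatzCM.InSigma ι {𝔓} σ ↔ σ ∘ (K → L) = φ₀`. [cite: Hsieh2014mu, §1.1] -/
theorem inSigma_singleton_iff' [IsCMField K] (hK : IsImaginaryQuadratic K) (h4 : finrank ℚ L = 4) {d : ℤ}
    (hd : ¬ IsSquare ((d : ℤ) : ZMod p)) {x : 𝓞 L} (hx : x ^ 2 = (d : 𝓞 L)) {𝔭 𝔭' : HeightOneSpectrum (𝓞 K)}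
    (h𝔭 : ((p : ℕ) : 𝓞 K) ∈ 𝔭.asIdeal) (h𝔭' : ((p : ℕ) : 𝓞 K) ∈ 𝔭'.asIdeal) (hne : 𝔭 ≠ 𝔭')
    {𝔓 𝔓' : HeightOneSpectrum (𝓞 L)} [𝔓.asIdeal.LiesOver 𝔭.asIdeal] [𝔓'.asIdeal.LiesOver 𝔭'.asIdeal]
    {ι : PadicAlgCl p ≃+* ℂ} {φ₀ : K →+* ℂ} (hι : ∀ k : 𝓞 K, k ∈ 𝔭.asIdeal ↔ ‖ι.symm (φ₀ (k : K))‖ < 1)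
    (σ : L →+* ℂ) :
    KatzCM.InSigma ι ({𝔓} : Finset (HeightOneSpectrum (𝓞 L))) σ ↔ σ.comp (algebraMap K L) = φ₀ := by
  have hne' : 𝔓 ≠ 𝔓' := ne_of_liesOver_ne hne
  unfold KatzCM.InSigma
  rw [Finset.mem_singleton]
  constructor
  · intro h
    rcases comp_algebraMap_eq_or hK φ₀ σ with hσ | hσ
    · exact hσ
    · rw [place_eq_of_comp_eq_conjugate hK h4 hd hx h𝔭 h𝔭' hne (𝔓' := 𝔓') hι hσ] at h
      exact absurd h.symm hne'
  · intro hσ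
    exact place_eq_of_comp_eq h4 hd hx h𝔭 h𝔭' hne (𝔓 := 𝔓) hι hσ

/-! ### §3 Hsieh's (d1) and `Σ`-positivity for `ϑ ∈ K′` -/

omit [NumberField L] in
/-- **(d1) for `ϑ ∈ K′`**: if `c_K y = −y` then `σ(y)` is purely imaginary under every complex embedding `σ` of `L`
(hypothesis `hϑ₁` of `KatzCM.exists_isBaseChangeLine` for `ϑ := y ∈ K′ ⊂ L`). [cite: Hsieh2014mu, §3.1 (d1)] -/
theorem re_apply_eq_zero_of_complexConj_eq_neg [IsCMField K] {y : K} (hy : IsCMField.complexConj K y = -y)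
    (σ : L →+* ℂ) : (σ (algebraMap K L y)).re = 0 := by
  have h := IsCMField.complexEmbedding_complexConj K (σ.comp (algebraMap K L)) y
  rw [hy, map_neg, RingHom.comp_apply] at h
  have hre := congrArg Complex.re h
  rw [Complex.neg_re, Complex.conj_re] at hre
  linarith

omit [NumberField K] [NumberField L] in
/-- Under an embedding restricting to `φ̄₀` on `K`, `Im σ(y) = −Im φ₀(y)`. [folklore] -/
theorem im_apply_of_comp_eq_conjugate {φ₀ : K →+* ℂ} {σ : L →+* ℂ}
    (hσ : σ.comp (algebraMap K L) = ComplexEmbedding.conjugate φ₀) (y : K) :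
    (σ (algebraMap K L y)).im = -(φ₀ y).im := by
  have h : σ (algebraMap K L y) = ComplexEmbedding.conjugate φ₀ y := by rw [← hσ, RingHom.comp_apply]
  rw [h, ComplexEmbedding.conjugate_coe_eq, Complex.conj_im]

/-- **`Σ`-positivity (`hϑ₂`) for `ϑ := y ∈ K′` with `Im φ₀(y) < 0`**: for every `σ ∈ Σ` (`KatzCM.InSigma ι {𝔓′} σ`),
`0 < Im σ(y)`. [cite: Hsieh2014mu, §3.1 (d1)] -/
theorem im_apply_pos_of_inSigma [IsCMField K] (hK : IsImaginaryQuadratic K) (h4 : finrank ℚ L = 4) {d : ℤ}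
    (hd : ¬ IsSquare ((d : ℤ) : ZMod p)) {x : 𝓞 L} (hx : x ^ 2 = (d : 𝓞 L)) {𝔭 𝔭' : HeightOneSpectrum (𝓞 K)}
    (h𝔭 : ((p : ℕ) : 𝓞 K) ∈ 𝔭.asIdeal) (h𝔭' : ((p : ℕ) : 𝓞 K) ∈ 𝔭'.asIdeal) (hne : 𝔭 ≠ 𝔭')
    {𝔓 𝔓' : HeightOneSpectrum (𝓞 L)} [𝔓.asIdeal.LiesOver 𝔭.asIdeal] [𝔓'.asIdeal.LiesOver 𝔭'.asIdeal]
    {ι : PadicAlgCl p ≃+* ℂ} {φ₀ : K →+* ℂ} (hι : ∀ k : 𝓞 K, k ∈ 𝔭.asIdeal ↔ ‖ι.symm (φ₀ (k : K))‖ < 1)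
    {y : K} (hneg : (φ₀ y).im < 0) (σ : L →+* ℂ) (hσ : KatzCM.InSigma ι ({𝔓'} : Finset (HeightOneSpectrum (𝓞 L))) σ) :
    0 < (σ (algebraMap K L y)).im := by
  rw [im_apply_of_comp_eq_conjugate ((inSigma_singleton_iff hK h4 hd hx h𝔭 h𝔭' hne (𝔓 := 𝔓) (𝔓' := 𝔓') hι σ).mp hσ)]
  linarith

omit [Algebra K L] in
/-- There is `y ∈ K`, `y ≠ 0`, anti-invariant under `c_K` with `Im φ₀(y) < 0` (take `±(u − c_K u)`). [folklore] -/
theorem exists_complexConj_eq_neg_im_neg [IsCMField K] (φ₀ : K →+* ℂ) :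
    ∃ y : K, y ≠ 0 ∧ IsCMField.complexConj K y = -y ∧ (φ₀ y).im < 0 := by
  obtain ⟨y, hy0, hy⟩ :=
    Summit.BirchSwinnertonDyer.BirchSwinnertonDyer.Theorems.BiquadraticEisensteinDescentEisensteinHeartFlatCMInertBadKPrimeBiquadraticCMField.exists_complexConj_eq_neg K
  -- `φ₀ y` is purely imaginary and non-zero
  have hre : (φ₀ y).re = 0 := by
    have h := IsCMField.complexEmbedding_complexConj K φ₀ y
    rw [hy, map_neg] at h
    have hre := congrArg Complex.re h
    rw [Complex.neg_re, Complex.conj_re] at hre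
    linarith
  have him : (φ₀ y).im ≠ 0 := by
    intro him
    apply hy0
    apply φ₀.injective
    rw [map_zero]
    exact Complex.ext hre him
  rcases lt_or_gt_of_ne him with hlt | hgt
  · exact ⟨y, hy0, hy, hlt⟩
  · refine ⟨-y, neg_ne_zero.mpr hy0, by rw [map_neg, hy], ?_⟩
    rw [map_neg, Complex.neg_im]
    linarith

end Summit.BirchSwinnertonDyer.BirchSwinnertonDyer.Theorems.BiquadraticEisensteinDescentEisensteinHeartFlatCMInertBadKPrimeSigmaOrientation

end
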